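import Summits.CriticalPhenomena.PercolationContinuityZ3.Theorems.Transplant.SharpnessSubgraphGrowth
import Literature.Barriers.CriticalPhenomena.AmenableInvariantPercolation
import Literature.Probability.LatticeModels.IsingPressureBounds
import Literature.Probability.Percolation.SiteSubgraphMonotonicity
import HarnessLib

/-!
# Transplant sharpness XXXVI — every nonempty subgraph of `ℤ^d` is amenable (Følner balls); so `W` and `G′` are amenable

builds on p205010 (kernel theorem, internal audit signed; external expert review pending).
Status sentence (coordinator 2026-08-20T04:30Z): "θ(p_c) = 0 on ℤ^d, all d ≥ 2 — kernel-verified (Lean 4/Mathlib,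
standard axioms); internal adversarial audit SIGNED 2026-08-20 04:29Z; external expert review pending."

Lane `prim-bschramm`, seat p5 (sharpness); memo `run/shared/lean/prim/bschramm/P5-SHARPNESS.md` §2 rows 5 and 83 (column
"amenable").  In the tree's vocabulary `Literature.Barriers.CriticalPhenomena.IsGraphAmenable` (Lyons–Peres §6.1: `Φ_E = 0`):
polynomial growth (`SharpnessSubgraphGrowth.ballVolume_induce_zd_le`) forces some graph ball `B(x,n)` to have
`|B(x,n+1)| ≤ (1+δ)|B(x,n)|`, and then `|∂_E B(x,n)| ≤ 2d · |B(x,n+1) ∖ B(x,n)| ≤ 2d·δ·|B(x,n)|`.  PROVED: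

* `induceZd_locallyFinite` — `ℤ^d[S]` is locally finite (instance); `card_incidenceFinset_induce_zd_le` (degree `≤ 2d`);
* `ballFin` — the graph balls of `ℤ^d[S]` as finsets; `outerBoundary_ballFin_subset` (`∂^{ex} B(n) ⊆ B(n+1) ∖ B(n)`);
* `exists_ball_small_growth` — for every `δ > 0` some `n` has `|B(n+1)| ≤ (1+δ) |B(n)|`;
* `isGraphAmenable_induce_zd` — **every nonempty induced subgraph of `ℤ^d` is amenable**;
* `gridWedge_isGraphAmenable`, `logWedge_isGraphAmenable` — rows 83 / 5, column "amenable", as kernel statements.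

References: R. Lyons, Y. Peres (2016), §6.1; I. Benjamini, O. Schramm (1996), Conj. 4; G. Grimmett, *Percolation* (1999), §11.5.
-/

noncomputable section

namespace Summit.CriticalPhenomena.PercolationContinuityZ3.Theorems.TransplantSharpness

open Finset Literature.Probability.LatticeModels Literature.Probability.Percolation Literature.Barriers.CriticalPhenomena

section Induce

variable {d : ℕ} {S : Set (Site d)}

/-- `ℤ^d[S]` is locally finite. [folklore] -/
instance induceZd_locallyFinite (S : Set (Site d)) : ((zdGraph d).induce S).LocallyFinite :=
  locallyFiniteComap (zdGraph d) Subtype.val_injective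

/-- Degrees in `ℤ^d[S]` are at most `2d`. [folklore] -/
theorem card_incidenceFinset_induce_zd_le (x : S) : #(((zdGraph d).induce S).incidenceFinset x) ≤ 2 * d := by
  classical
  rw [SimpleGraph.card_incidenceFinset_eq_degree, ← SimpleGraph.card_neighborFinset_eq_degree]
  -- the neighbour finset injects into the lattice neighbour finset of `x`
  have hmap : (((zdGraph d).induce S).neighborFinset x).map (Function.Embedding.subtype _) ⊆
      (zdGraph d).neighborFinset (x : Site d) := by
    intro y hy
    rw [Finset.mem_map] at hy
    obtain ⟨z, hz, rfl⟩ := hy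
    rw [SimpleGraph.mem_neighborFinset] at hz ⊢
    exact (SimpleGraph.comap_adj).1 hz
  calc #(((zdGraph d).induce S).neighborFinset x)
      = #((((zdGraph d).induce S).neighborFinset x).map (Function.Embedding.subtype _)) := (Finset.card_map _).symm
    _ ≤ #((zdGraph d).neighborFinset (x : Site d)) := Finset.card_le_card hmap
    _ = 2 * d := card_neighborFinset_zdGraph_holds (x : Site d)

/-- Graph balls of `ℤ^d[S]` are finite. [folklore] -/
theorem graphBall_induce_zd_finite (x : S) (n : ℕ) : (graphBall ((zdGraph d).induce S) x n).Finite := by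
  classical
  refine Set.Finite.of_finite_image (f := fun y : S => (y : Site d) - (x : Site d)) ?_ ?_
  · exact (box d n).finite_toSet.subset (by
      rintro _ ⟨y, hy, rfl⟩
      exact Finset.mem_coe.2 (mem_box_of_mem_graphBall_induce x hy))
  · intro y _ z _ h
    exact Subtype.ext (sub_left_injective h)

/-- The graph ball `B(x,n)` of `ℤ^d[S]` as a finset. House notation. -/
def ballFin (x : S) (n : ℕ) : Finset S := (graphBall_induce_zd_finite x n).toFinset

/-- Membership in `ballFin`. [folklore] -/
theorem mem_ballFin {x : S} {n : ℕ} {y : S} : y ∈ ballFin x n ↔ y ∈ graphBall ((zdGraph d).induce S) x n :=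
  Set.Finite.mem_toFinset _

/-- `|ballFin x n| = |B(x,n)|`. [folklore] -/
theorem card_ballFin (x : S) (n : ℕ) : #(ballFin x n) = ballVolume ((zdGraph d).induce S) x n := by
  rw [ballVolume, ballFin, Set.ncard_eq_toFinset_card _ (graphBall_induce_zd_finite x n)]

/-- Balls increase. [folklore] -/
theorem ballFin_mono (x : S) {m n : ℕ} (h : m ≤ n) : ballFin x m ⊆ ballFin x n := by
  intro y hy
  rw [mem_ballFin] at hy ⊢
  exact graphBall_mono _ _ h hy

/-- The outer vertex boundary of `B(x,n)` lies in the shell `B(x,n+1) ∖ B(x,n)`. [folklore] -/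
theorem outerBoundary_ballFin_subset (x : S) (n : ℕ) :
    outerBoundary ((zdGraph d).induce S) (ballFin x n) ⊆ ballFin x (n + 1) \ ballFin x n := by
  classical
  intro y hy
  rw [mem_outerBoundary_iff] at hy
  obtain ⟨hyn, z, hz, hadj⟩ := hy
  rw [Finset.mem_sdiff]
  refine ⟨?_, hyn⟩
  rw [mem_ballFin] at hz ⊢
  obtain ⟨w, hw⟩ := hz
  exact ⟨w.concat hadj.symm, by rw [SimpleGraph.Walk.length_concat]; omega⟩

/-- **Polynomial growth forces a slowly growing ball**: for every `δ > 0` there is `n` with `|B(x,n+1)| ≤ (1+δ)|B(x,n)|`.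
[cite: LyonsPeres2016, §6.1 (subexponential growth implies amenability)] -/
theorem exists_ball_small_growth (x : S) {δ : ℝ} (hδ : 0 < δ) :
    ∃ n : ℕ, (#(ballFin x (n + 1)) : ℝ) ≤ (1 + δ) * #(ballFin x n) := by
  by_contra h
  push Not at h
  -- then `|B(n)| ≥ (1+δ)^n`
  have hgrow : ∀ n : ℕ, (1 + δ) ^ n ≤ (#(ballFin x n) : ℝ) := by
    intro n
    induction n with
    | zero =>
      have : 1 ≤ #(ballFin x 0) := Finset.card_pos.2 ⟨x, mem_ballFin.2 (mem_graphBall_self _ x 0)⟩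
      have : (1 : ℝ) ≤ #(ballFin x 0) := by exact_mod_cast this
      simpa using this
    | succ n ih =>
      have h1 := h n
      have hpos : (0 : ℝ) ≤ 1 + δ := by linarith
      calc (1 + δ) ^ (n + 1) = (1 + δ) * (1 + δ) ^ n := by ring
        _ ≤ (1 + δ) * #(ballFin x n) := mul_le_mul_of_nonneg_left ih hpos
        _ ≤ #(ballFin x (n + 1)) := h1.le
  obtain ⟨n, hn1, hn2⟩ := ((Filter.Eventually.of_forall hgrow).and
    (eventually_pow_lt_const_pow d (show (1 : ℝ) < 1 + δ by linarith))).exists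
  have hvol : (#(ballFin x n) : ℝ) ≤ (2 * n + 1) ^ d := by
    rw [card_ballFin]; exact_mod_cast ballVolume_induce_zd_le x n
  linarith

/-- **Every nonempty induced subgraph of `ℤ^d` is amenable** (`Φ_E(ℤ^d[S]) = 0`, Følner sets = graph balls).
[cite: LyonsPeres2016, §6.1 (Φ_E = 0; subexponential growth)] -/
theorem isGraphAmenable_induce_zd (x : S) : IsGraphAmenable ((zdGraph d).induce S) := by
  classical
  intro ε hε
  set δ : ℝ := ε / (2 * d + 1) with hδ
  have hδpos : 0 < δ := by positivity
  obtain ⟨n, hn⟩ := exists_ball_small_growth x hδpos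
  refine ⟨ballFin x n, ⟨x, mem_ballFin.2 (mem_graphBall_self _ x n)⟩, ?_⟩
  have hbd := card_edgeBoundary_le_of_degree_le ((zdGraph d).induce S) card_incidenceFinset_induce_zd_le (ballFin x n)
  have hout : #(outerBoundary ((zdGraph d).induce S) (ballFin x n)) ≤ #(ballFin x (n + 1)) - #(ballFin x n) := by
    calc #(outerBoundary ((zdGraph d).induce S) (ballFin x n)) ≤ #(ballFin x (n + 1) \ ballFin x n) :=
          Finset.card_le_card (outerBoundary_ballFin_subset x n)
      _ = #(ballFin x (n + 1)) - #(ballFin x n) := Finset.card_sdiff_of_subset (ballFin_mono x (Nat.le_succ n))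
  have hsub : #(ballFin x n) ≤ #(ballFin x (n + 1)) := Finset.card_le_card (ballFin_mono x (Nat.le_succ n))
  have h1 : (#(edgeBoundary ((zdGraph d).induce S) (ballFin x n)) : ℝ) ≤
      2 * d * ((#(ballFin x (n + 1)) : ℝ) - #(ballFin x n)) := by
    have : (#(edgeBoundary ((zdGraph d).induce S) (ballFin x n)) : ℝ) ≤
        ((2 * d * (#(ballFin x (n + 1)) - #(ballFin x n)) : ℕ) : ℝ) := by exact_mod_cast hbd.trans (Nat.mul_le_mul_left _ hout)
    rw [Nat.cast_mul, Nat.cast_sub hsub] at this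
    exact_mod_cast this
  have h2 : ((#(ballFin x (n + 1)) : ℝ) - #(ballFin x n)) ≤ δ * #(ballFin x n) := by linarith
  have hd0 : (0 : ℝ) ≤ 2 * d := by positivity
  have hK : (0 : ℝ) ≤ #(ballFin x n) := Nat.cast_nonneg _
  calc (#(edgeBoundary ((zdGraph d).induce S) (ballFin x n)) : ℝ)
      ≤ 2 * d * (δ * #(ballFin x n)) := h1.trans (mul_le_mul_of_nonneg_left h2 hd0)
    _ = (2 * d / (2 * d + 1)) * ε * #(ballFin x n) := by rw [hδ]; ring
    _ ≤ 1 * ε * #(ballFin x n) := by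
        refine mul_le_mul_of_nonneg_right (mul_le_mul_of_nonneg_right ?_ hε.le) hK
        rw [div_le_one (by positivity)]; linarith
    _ = ε * #(ballFin x n) := by ring

end Induce

/-! ## Rows 83 and 5 -/

/-- **The gridded wedge is amenable.** [cite: LyonsPeres2016, §6.1] -/
theorem gridWedge_isGraphAmenable (a b : ℝ) (M : ℕ) : IsGraphAmenable (gridWedgeGraph a b M) :=
  isGraphAmenable_induce_zd (gridWedgeOrigin a b M)

/-- **Grimmett's logarithmic wedge is amenable.** [cite: LyonsPeres2016, §6.1] -/
theorem logWedge_isGraphAmenable (a b : ℝ) : IsGraphAmenable (logWedgeGraph a b) :=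
  isGraphAmenable_induce_zd (logWedgeOrigin a b)

end Summit.CriticalPhenomena.PercolationContinuityZ3.Theorems.TransplantSharpness

end
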